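import Mathlib
import Summits.PneNP.PneNP.Theses.OneSlice
import Summits.PneNP.PneNP.Theorems.OneSliceSliceTargetSplit
import Summits.PneNP.PneNP.Theorems.OneSliceSliceTargetSplitStability
import Summits.PneNP.PneNP.Theorems.OneSliceMonotoneContinuationDefs
import Summits.PneNP.PneNP.Theorems.OneSliceMonotoneContinuationWindow

/-!
# Route OneSlice, crux `MonotoneContinuation` (stmt-PneNP-18471), line `Sketch_ideator1_r1` — bridge `MC → flat-above`,
part 5: small facts for the assembly

The two slices avoid the extreme inputs (`bridge_nonextreme`, `bridge_natfacts`), the eventual facts in `n`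
(`eventually_bridge`), the real-number facts at one `n` (`bridge_realfacts`) and the final accounting (`bridge_final`),
each in a clean context.
-/

set_option linter.dupNamespace false -- `Summit.PneNP.PneNP.…`: summit = sub-problem (D-0017)

namespace Summit.PneNP.PneNP.Theorems.MonotoneContinuation

open Literature.Computability.Complexity hiding supp mem_supp
open Finset hiding slice
open Filter hiding mem_sdiff
open Classical
open Summit.PneNP.PneNP.Theorems (card_slice binomialWeight_tail_le binomialWeight_nonneg)
open Summit.PneNP.PneNP.Theorems.ConstantBand.Negative (Edge thr Central slice)
open Summit.PneNP.PneNP.Theorems.SingleThreshold.Negative (pc tendsto_pc)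
open Summit.PneNP.PneNP.Theorems.SliceACZero.Negative (supp mem_supp card_supp)
open Summit.PneNP.PneNP.Theorems.SliceTargetSplit (nbhd mem_nbhd transport ind l1 card_nbhd_of_le comp_iff_supp
  transport_ind_mem ind_nonneg ind_le_one l1_triangle l1_nonneg transport_nonneg rdist_eq_l1)

noncomputable section

variable {n : ℕ}

/-! ## Part 3d — small facts for the assembly (extreme inputs, eventual facts, accounting) -/

/-- A vector with at least one and at most `N - 1` edges is neither of the two extreme inputs. -/
theorem bridge_nonextreme {y : Edge n → Bool} (h1 : 1 ≤ edgeCount y) (h2 : edgeCount y + 1 ≤ n.choose 2) :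
    (∃ e, y e = false) ∧ (∃ e, y e = true) := by
  constructor
  · by_contra hc
    push Not at hc
    have : edgeCount y = n.choose 2 := by
      rw [edgeCount, ← card_edgeSet_top_fin n, ← card_univ]
      congr 1; ext e; simp [hc e]
    omega
  · by_contra hc
    push Not at hc
    have : edgeCount y = 0 := by
      rw [edgeCount, Finset.card_eq_zero, filter_eq_empty_iff]
      intro e _; simp [hc e]
    omega

/-- **Eventual facts for the bridge.** -/
theorem eventually_bridge {k : ℕ} (hk : 3 ≤ k) (M₀ M₁ : ℝ) {δ : ℝ} (hδ : 0 < δ) :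
    ∀ᶠ n : ℕ in atTop, 0 < pc n k ∧ pc n k ≤ 1 / 8 ∧ 2 ≤ n ∧ M₀ ≤ ((n.choose 2 : ℕ) : ℝ) * pc n k ∧
      M₁ ≤ (thr k n : ℝ) ∧ pc n k ≤ δ ∧ ∀ j : ℕ, Central k n j → 1 ≤ j ∧ j ≤ n.choose 2 := by
  have hμ := tendsto_mean hk
  have hm : Tendsto (fun n : ℕ => (thr k n : ℝ)) atTop atTop :=
    tendsto_natCast_atTop_atTop.comp (tendsto_nat_floor_atTop.comp hμ)
  have hp := (tendsto_pc (show 2 ≤ k by omega)).eventually (eventually_le_nhds hδ)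
  filter_upwards [eventually_central hk 0, eventually_ge_atTop 2, hμ.eventually_ge_atTop M₀, hm.eventually_ge_atTop M₁, hp]
    with n hcen hn2 hM₀ hM₁ hpδ
  obtain ⟨hp0, hp8, hj⟩ := hcen
  exact ⟨hp0, hp8, hn2, hM₀, hM₁, hpδ, fun j hjc => ⟨by have := (hj j hjc).2.1; omega, (hj j hjc).1⟩⟩

/-- Final accounting of the bridge, in a clean context. -/
theorem bridge_final {η cb c₀ ε ηMC p mN t : ℝ} (hη : 0 < η) (hcb : 0 < cb) (hc₀ : 0 < c₀)
    (hηMC : ηMC = η * cb / 640) (hε : ε ≤ η * c₀ / 6400) (hmN : mN ≤ 20 * p) (hp : 20 * p ≤ η / 2240) (ht : 4 / t ≤ η / 16) :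
    2 * (4 / t + 6 * (2 / cb * ηMC + 10 * (ε / c₀) + 7 / 2 * mN)) ≤ η / 5 ∧ 2 * (ε / c₀) + 2 * (η / 5) ≤ η := by
  have h1 : 2 / cb * ηMC = η / 320 := by rw [hηMC]; field_simp; ring
  have h2 : ε / c₀ ≤ η / 6400 := by rw [div_le_iff₀ hc₀]; linarith
  constructor
  · rw [h1]; linarith
  · linarith

/-- Natural-number facts at one `n`: the two slices avoid the extreme inputs. -/
theorem bridge_natfacts {L m j N : ℕ} (hq : L + 8 ≤ Nat.sqrt m) (hjm : j ≤ m) (hN : 8 * (L + 2) * m ≤ N) :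
    j + 1 ≤ N ∧ j + L * Nat.sqrt j + 1 + 1 ≤ N := by
  have hjq : Nat.sqrt j ≤ Nat.sqrt m := Nat.sqrt_le_sqrt hjm
  have hqq : Nat.sqrt m * Nat.sqrt m ≤ m := Nat.sqrt_le m
  have h1 : L * Nat.sqrt j ≤ L * Nat.sqrt m := Nat.mul_le_mul_left L hjq
  have h2 : (L + 8) * Nat.sqrt m ≤ Nat.sqrt m * Nat.sqrt m := Nat.mul_le_mul_right _ hq
  have h3 : 16 * m ≤ 8 * (L + 2) * m := Nat.mul_le_mul_right m (by omega)
  have h8 : 8 ≤ Nat.sqrt m := by omega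
  have h4 : 8 * 8 ≤ Nat.sqrt m * Nat.sqrt m := Nat.mul_le_mul h8 h8
  constructor
  · omega
  · nlinarith

/-- Real-number facts at one `n`. -/
theorem bridge_realfacts {p η : ℝ} {m N L : ℕ} (hp0 : 0 < p) (hmμ : (m : ℝ) ≤ (N : ℝ) * p)
    (hpδ : p ≤ min (1 / (8 * ((L : ℝ) + 2))) (η / 44800))
    (hL9 : ((L : ℝ) + 9) ^ 2 ≤ m) (h40 : (40 * (((L : ℝ) + 6) / 2)) ^ 2 ≤ m) :
    L + 8 ≤ Nat.sqrt m ∧ 40 * (((L : ℝ) + 6) / 2) ≤ Real.sqrt m ∧ 8 * (L + 2) * m ≤ N ∧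
      20 * (m : ℝ) / N ≤ 20 * p ∧ 20 * p ≤ η / 2240 := by
  refine ⟨?_, Real.le_sqrt_of_sq_le h40, ?_, ?_, ?_⟩
  · rw [Nat.le_sqrt]
    have : (((L + 8) * (L + 8) : ℕ) : ℝ) ≤ m := by push_cast; nlinarith
    exact_mod_cast this
  · have h1 : p ≤ 1 / (8 * ((L : ℝ) + 2)) := hpδ.trans (min_le_left _ _)
    have hN0 : (0 : ℝ) ≤ N := Nat.cast_nonneg _
    have h2 : p * (8 * ((L : ℝ) + 2)) ≤ 1 := by rw [le_div_iff₀ (by positivity)] at h1; exact h1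
    have h3 : (m : ℝ) * (8 * ((L : ℝ) + 2)) ≤ (N : ℝ) * (p * (8 * ((L : ℝ) + 2))) := by
      have := mul_le_mul_of_nonneg_right hmμ (show (0 : ℝ) ≤ 8 * ((L : ℝ) + 2) by positivity)
      linarith
    have h4 : (N : ℝ) * (p * (8 * ((L : ℝ) + 2))) ≤ N := by nlinarith
    have : ((8 * (L + 2) * m : ℕ) : ℝ) ≤ N := by push_cast; linarith
    exact_mod_cast this
  · rcases Nat.eq_zero_or_pos N with hN0 | hNpos
    · simp only [hN0, Nat.cast_zero, div_zero]; linarith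
    · have hNr : (0 : ℝ) < N := by exact_mod_cast hNpos
      rw [div_le_iff₀ hNr]; nlinarith
  · have : p ≤ η / 44800 := hpδ.trans (min_le_right _ _)
    linarith


/-! ## Registered form -/

/-- **Natural-number facts of the bridge** (registered sub-goal `bridgeNatfacts` of stmt-PneNP-18471), written out. [folklore] -/
theorem bridgeNatfacts :
  ∀ (L m j N : ℕ), L + 8 ≤ Nat.sqrt m → j ≤ m → 8 * (L + 2) * m ≤ N → j + 1 ≤ N ∧ j + L * Nat.sqrt j + 1 + 1 ≤ N :=
  fun _ _ _ _ hq hjm hN => bridge_natfacts hq hjm hN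

end

end Summit.PneNP.PneNP.Theorems.MonotoneContinuation
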